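import Summits.QuantumFields.BalabanUV.T4Continuum.Support.NE3DirIterMajorant
import Summits.QuantumFields.BalabanUV.T4Continuum.Support.NE3CombVsTowerEnd
import Summits.QuantumFields.BalabanUV.T4Continuum.Support.NE3ShellCount
import HarnessLib

/-!
# T⁴ programme, node NE3, route Π (Γ″) · γ4″ (file B1) — THE EXACT TILING OF THE STRAIGHT STEP AND THE COULOMB PROFILE LEMMA

NE3 formalisation swarm `b2b-balaban-t4-ne3-formalise-*`, LEAF PROVER 04 (gen 8), written for the Π-C-3γ holder `leaf-02-g8` (γ4″ «the ONE linear
letter of `dirIter L (j+1) W Q`», journal HOME/CLAIMS.log l.25003 ∕ l.25119 ∕ l.25351).  Files A∕A′ (`NE3QbarIterMajorant`, `NE3DirIterMajorant`)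
dominate `QbarIter`∕`framePotW`∕`dirIter` by the positive towers `majIter`∕`frameMaj`; files B1–B3 evaluate those towers k-free; the END is
`NE3LinearTowerProfile`.

CONTENT (all [folklore]; 0 sorry; real DATA defs `segStepM`, `prof`, `profW`, `cP` → async audit; the ℓ^∞ shell count is `NE3ShellCount`):
* §1 THE TILING `(segStep L)^[r] = segStepM (L^r)` — the `r`-fold straight step on weights is EXACTLY the `L^r`-block mean of the `L^r` straight
  segment sums (K4-0's `sum_block_line_reindex`): the reason every Duhamel term of file B2 is read DIRECTLY from its birth level;
* §2 the Coulomb profile `prof p c y = (1 + |y − c|₁∕2)^{−p}`, the ℓ^∞ shell count `#{u ∈ A : |u − c|_∞ = s} ≤ 2d(2s+1)^{d−1}` (`box s ∖ box (s−1)`,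
  `geom_sum₂`), the near-corner sum `Σ_{u∈A} (1 + |u−c|_∞∕2)^{−p} ≤ 2d·4^{d−1}(S+1)(1+S∕2)^{d−1−p}` (`p + 1 ≤ d`), and **THE PROFILE LEMMA
  `segStepM_profW_le`: `segStepM M (profW p c) z κ ≤ cP d p·(M∕M^p)·prof p (blockIdx M c) z`** for ANY fine corner `c` (re-centred on its block index
  `⌊c∕M⌋`; far from the corner by sup × count, near it by multiplicity `≤ M` of the slab map and the shell count) — ONE geometric constant `cP`.

HONEST: real analysis on `ℤ^d` on OUR frame; nothing about minimisers, (Π-REG-γ″), Π-C-3γ″, T-E_w♯ or NE3 is asserted; NE3 NOT proved; spine PROVED 0∕9;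
finite T⁴ rung (B)+1 — NOT infinite volume, NOT mass gap, NOT BetaPertH, NOT Clay.  PLACEMENT: `Summits/QuantumFields/BalabanUV/` (cell rule).
-/

set_option autoImplicit false

open scoped BigOperators Matrix.Norms.L2Operator
open Finset

namespace Summit.QuantumFields.BalabanUV.T4Continuum.NE3MajorantProfile

open Literature.MathematicalPhysics.QuantumFieldTheory.Balaban1983to89
open B7Prop1Explicit B7Prop2Explicit
open T4AveragingDeficitWall (box)
open T4AveragingDeficitWallBoundary (periodBox mem_periodBox card_periodBox)
open AveragingDeficitCounting (mem_box_iff card_box_eq blockIdx mem_box_blockBase)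
open NE3ShellCount (linf linf_le_l1 mem_box_zero_iff card_shell_le sum_linfProf_le)
open NE3BlockLineAverage (sum_univ_boxVec)
open NE3CombVsTowerEnd (sum_block_line_reindex fine_site_eq)
open NE3CombVsTowerStraighten (l1_natCast_smul l1_le_of_mem_periodBox)
open NE3QbarIterMajorant (lsum lsum_nil lsum_cons segW segStep)

noncomputable section

variable {d : ℕ}

/-! ## §1 The exact tiling of the straight step on weights -/

/-- `lsum` of a straight segment is the plain sum `Σ_{i<L} ω (p + i•e_κ) κ`. [folklore] -/
theorem lsum_seg_eq_sum (ω : Site d → Fin d → ℝ) (κ : Fin d) :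
    ∀ (L : ℕ) (p : Site d), lsum ω p (seg κ (L : ℤ)) = ∑ i ∈ Finset.range L, ω (p + (i : ℤ) • e κ) κ
  | 0, p => by simp
  | L + 1, p => by
    rw [seg_natCast, List.replicate_succ, lsum_cons, ← seg_natCast, lsum_seg_eq_sum ω κ L (p + Letter.vec (κ, true)),
      Finset.sum_range_succ', add_comm]
    simp only [Letter.vec_true, if_true, Nat.cast_zero, zero_smul, add_zero, Nat.cast_succ, add_smul, one_smul]
    congr 1
    refine Finset.sum_congr rfl fun i _ => ?_
    congr 1
    abel

/-- THE DIRECT `M`-BLOCK READING of the straight step: `segStepM M ω (z,κ) := M^{−d} Σ_{v∈[0,M)^d} Σ_{t<M} ω (M•z + v + t•e_κ) κ`. [folklore] -/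
def segStepM (M : ℕ) (ω : Site d → Fin d → ℝ) : Site d → Fin d → ℝ :=
  fun z κ => ((M : ℝ) ^ d)⁻¹ * ∑ v ∈ periodBox (d := d) M, ∑ t ∈ range M, ω (((M : ℕ) : ℤ) • z + v + (t : ℤ) • e κ) κ

/-- One straight step is the `L`-block reading. [folklore] -/
theorem segStep_eq_segStepM (L : ℕ) (ω : Site d → Fin d → ℝ) : segStep L ω = segStepM L ω := by
  funext z κ
  simp only [segStep, segW, segStepM, lsum_seg_eq_sum, ← Finset.mul_sum]
  congr 1
  exact sum_univ_boxVec L (fun v => ∑ i ∈ range L, ω ((L : ℤ) • z + v + (i : ℤ) • e κ) κ)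

/-- `segStepM 1 = id`. [folklore] -/
theorem segStepM_one (ω : Site d → Fin d → ℝ) : segStepM 1 ω = ω := by
  funext z κ
  simp only [segStepM, Nat.cast_one, one_pow, inv_one, one_mul, one_smul, Finset.range_one, Finset.sum_singleton, Nat.cast_zero,
    zero_smul, add_zero]
  rw [← sum_univ_boxVec, Fintype.sum_unique]
  have h : boxVec (d := d) 1 default = 0 := by
    funext κ'; simp [boxVec, Fin.val_eq_zero]
  rw [h, add_zero]

/-- **THE TILING**: `(segStep L)^[r] = segStepM (L^r)` — the `r`-fold straight step is the `L^r`-block mean of the `L^r`-segment sums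
(`[0,L^{r+1})^d × [0,L^{r+1})` = coarse copies × fine offsets, K4-0's `sum_block_line_reindex`). [folklore] -/
theorem iterate_segStep {L : ℕ} (hL : 1 ≤ L) : ∀ (r : ℕ) (ω : Site d → Fin d → ℝ), (segStep L)^[r] ω = segStepM (L ^ r) ω
  | 0, ω => by rw [Function.iterate_zero, id_eq, pow_zero, segStepM_one]
  | r + 1, ω => by
      rw [Function.iterate_succ_apply, iterate_segStep hL r, segStep_eq_segStepM]
      funext z κ
      simp only [segStepM]
      rw [sum_block_line_reindex hL r (fun v i => ω ((((L ^ (r + 1) : ℕ) : ℤ)) • z + v + (i : ℤ) • e κ) κ)]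
      simp only [fine_site_eq, ← sum_univ_boxVec L (fun v => ∑ i ∈ range L, ω ((L : ℤ) • _ + v + (i : ℤ) • e κ) κ)]
      simp only [Finset.mul_sum]
      refine Finset.sum_congr rfl fun v₁ _ => Finset.sum_congr rfl fun i₁ _ => ?_
      refine Finset.sum_congr rfl fun r' _ => Finset.sum_congr rfl fun i' _ => ?_
      rw [← mul_assoc]
      congr 1
      push_cast
      ring

/-! ## §2 The Coulomb profile and the profile lemma -/

/-- THE COULOMB PROFILE of exponent `p` centred at `c`: `prof p c y = (1 + |y − c|₁∕2)^{−p}`. [folklore] -/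
def prof (p : ℕ) (c y : Site d) : ℝ := ((1 + (l1 (y - c) : ℝ) / 2) ^ p)⁻¹

/-- The profile as a (direction-blind) bond weight. [folklore] -/
def profW (p : ℕ) (c : Site d) : Site d → Fin d → ℝ := fun y _ => prof p c y

/-- `0 < prof ≤ 1`. [folklore] -/
theorem prof_pos (p : ℕ) (c y : Site d) : 0 < prof p c y := by
  simp only [prof]
  exact inv_pos.mpr (pow_pos (by positivity) _)

/-- `prof ≤ 1`. [folklore] -/
theorem prof_le_one (p : ℕ) (c y : Site d) : prof p c y ≤ 1 := by
  unfold prof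
  have h1 : (1 : ℝ) ≤ (1 + (l1 (y - c) : ℝ) / 2) ^ p :=
    one_le_pow₀ (by have := Nat.cast_nonneg (α := ℝ) (l1 (y - c)); linarith)
  exact inv_le_one_of_one_le₀ h1

/-- `0 ≤ prof`. [folklore] -/
theorem prof_nonneg (p : ℕ) (c y : Site d) : 0 ≤ prof p c y := (prof_pos p c y).le

/-- Monotonicity of the profile in the distance: `|y − c|₁ ≥ D′` with `(1 + D∕2) ≤ A·(1 + D′∕2)`… stated as the elementary comparison
`1 + D∕2 ≤ A·(1 + |y−c|₁∕2)`, `0 < 1 + D∕2` ⟹ `prof p c y ≤ A^p·(1 + D∕2)^{−p}`. [folklore] -/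
theorem prof_le_of_le {p : ℕ} {c y : Site d} {A D : ℝ} (hD : 0 < 1 + D / 2)
    (h : 1 + D / 2 ≤ A * (1 + (l1 (y - c) : ℝ) / 2)) : prof p c y ≤ A ^ p * ((1 + D / 2) ^ p)⁻¹ := by
  unfold prof
  have hy : 0 < 1 + (l1 (y - c) : ℝ) / 2 := by positivity
  rw [← one_div, ← one_div, mul_one_div, div_le_div_iff₀ (by positivity) (by positivity), one_mul, ← mul_pow]
  exact pow_le_pow_left₀ hD.le h p

/-- The constant of the profile lemma: far regime `4^p`, near regime `2d·4^{d−1}·(6d+3)·(6d+2)^{d−1−p}·(2d+2)^p`. [folklore] -/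
def cP (d p : ℕ) : ℝ := 4 ^ p + 2 * d * 4 ^ (d - 1) * (6 * d + 3) * (6 * (d : ℝ) + 2) ^ (d - 1 - p) * (2 * (d : ℝ) + 2) ^ p

/-- `0 ≤ cP`. [folklore] -/
theorem cP_nonneg (d p : ℕ) : 0 ≤ cP d p := by unfold cP; positivity

/-- `4^p ≤ cP`. [folklore] -/
theorem four_pow_le_cP (d p : ℕ) : (4 : ℝ) ^ p ≤ cP d p := by
  unfold cP; have : (0 : ℝ) ≤ 2 * d * 4 ^ (d - 1) * (6 * d + 3) * (6 * (d : ℝ) + 2) ^ (d - 1 - p) * (2 * (d : ℝ) + 2) ^ p := by positivity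
  linarith

/-- The block index is within `d(M−1)` of the point (ℓ¹): `|c − M•⌊c∕M⌋|₁ ≤ d·(M − 1)`. [folklore] -/
theorem l1_sub_blockIdx_le {M : ℕ} (hM : 1 ≤ M) (c : Site d) : (l1 (c - ((M : ℕ) : ℤ) • blockIdx M c) : ℝ) ≤ d * ((M : ℝ) - 1) := by
  have h := mem_box_blockBase M hM c
  rw [mem_box_iff] at h
  have hnat : l1 (c - ((M : ℕ) : ℤ) • blockIdx M c) ≤ d * (M - 1) := by
    unfold l1
    calc ∑ i, ((c - ((M : ℕ) : ℤ) • blockIdx M c) i).natAbs ≤ ∑ _i : Fin d, (M - 1) := Finset.sum_le_sum fun i _ => by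
            have hi := h i
            have : ((((c - ((M : ℕ) : ℤ) • blockIdx M c) i).natAbs : ℕ) : ℤ) ≤ ((M - 1 : ℕ) : ℤ) := by
              rw [Int.natCast_natAbs]; simpa [Pi.sub_apply] using hi
            exact_mod_cast this
      _ = d * (M - 1) := by simp
  have : ((l1 (c - ((M : ℕ) : ℤ) • blockIdx M c) : ℕ) : ℝ) ≤ ((d * (M - 1) : ℕ) : ℝ) := by exact_mod_cast hnat
  rw [Nat.cast_mul, Nat.cast_sub hM] at this
  simpa using this

/-- **THE PROFILE LEMMA**: for `1 ≤ M`, `p + 1 ≤ d` and ANY fine corner `c`,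
`segStepM M (profW p c) z κ ≤ cP d p · (M ∕ M^p) · prof p (blockIdx M c) z` — the `M`-block mean of the `M`-segment sums of the profile
centred at `c` is the coarse profile centred at the block index `⌊c∕M⌋`, diluted by `M^{1−p}` (far from the corner: each of the `M^{d+1}` terms is
`≤ (4∕M)^p·prof`; near the corner: multiplicity `≤ M` of the slab map and the ℓ^∞-shell count). [folklore] -/
theorem segStepM_profW_le (hd : 1 ≤ d) {p : ℕ} (hp : p + 1 ≤ d) {M : ℕ} (hM : 1 ≤ M) (c z : Site d) (κ : Fin d) :
    segStepM M (profW p c) z κ ≤ cP d p * ((M : ℝ) / (M : ℝ) ^ p) * prof p (blockIdx M c) z := by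
  classical
  set c' : Site d := blockIdx M c with hc'def
  have hM0 : (0 : ℝ) < M := by exact_mod_cast (by omega : 0 < M)
  have hMd : (0 : ℝ) < (M : ℝ) ^ d := by positivity
  have hd0 : (0 : ℝ) ≤ d := Nat.cast_nonneg d
  set D : ℕ := l1 (z - c') with hDdef
  have hprofz : prof p c' z = ((1 + (D : ℝ) / 2) ^ p)⁻¹ := rfl
  have hcc : (l1 (c - ((M : ℕ) : ℤ) • c') : ℝ) ≤ d * M := by
    have := l1_sub_blockIdx_le (d := d) hM c
    rw [← hc'def] at this; nlinarith
  -- distance of a slab point to the corner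
  have hdist : ∀ v ∈ periodBox (d := d) M, ∀ t ∈ range M,
      (M : ℝ) * D - (2 * d + 1) * M ≤ (l1 (((M : ℕ) : ℤ) • z + v + (t : ℤ) • e κ - c) : ℝ)
      ∧ (l1 (((M : ℕ) : ℤ) • z + v + (t : ℤ) • e κ - c) : ℝ) ≤ (M : ℝ) * D + (2 * d + 1) * M := by
    intro v hv t ht
    rw [Finset.mem_range] at ht
    set w : Site d := v + (t : ℤ) • e κ - (c - ((M : ℕ) : ℤ) • c') with hwdef
    have hsplit : ((M : ℕ) : ℤ) • z + v + (t : ℤ) • e κ - c = ((M : ℕ) : ℤ) • (z - c') + w := by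
      rw [hwdef, smul_sub]; abel
    have hMD : l1 (((M : ℕ) : ℤ) • (z - c')) = M * D := l1_natCast_smul M _
    have hw : (l1 w : ℝ) ≤ (2 * d + 1) * M := by
      have h1 := l1_add_le (v + (t : ℤ) • e κ) (-(c - ((M : ℕ) : ℤ) • c'))
      rw [← sub_eq_add_neg, l1_neg] at h1
      have h2 := l1_add_le v ((t : ℤ) • e κ)
      have h3 := l1_le_of_mem_periodBox hv
      have h4 : l1 ((t : ℤ) • e κ : Site d) = t := BlockAverageDbarLinNorms.l1_natCast_smul_e t κ
      have h5 : (t : ℝ) ≤ M := by exact_mod_cast ht.le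
      have h1' : (l1 w : ℝ) ≤ l1 (v + (t : ℤ) • e κ) + l1 (c - ((M : ℕ) : ℤ) • c') := by rw [hwdef]; exact_mod_cast h1
      have h2' : (l1 (v + (t : ℤ) • e κ) : ℝ) ≤ l1 v + l1 ((t : ℤ) • e κ : Site d) := by exact_mod_cast h2
      rw [h4] at h2'
      nlinarith
    have hup := l1_add_le (((M : ℕ) : ℤ) • (z - c')) w
    have hlow : l1 (((M : ℕ) : ℤ) • (z - c')) ≤ l1 (((M : ℕ) : ℤ) • (z - c') + w) + l1 w := by
      have := l1_add_le (((M : ℕ) : ℤ) • (z - c') + w) (-w)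
      rw [add_neg_cancel_right, l1_neg] at this
      exact this
    rw [hsplit]
    constructor
    · have : ((l1 (((M : ℕ) : ℤ) • (z - c'))) : ℝ) ≤ l1 (((M : ℕ) : ℤ) • (z - c') + w) + l1 w := by exact_mod_cast hlow
      rw [hMD] at this; push_cast at this; linarith
    · have : (l1 (((M : ℕ) : ℤ) • (z - c') + w) : ℝ) ≤ l1 (((M : ℕ) : ℤ) • (z - c')) + l1 w := by exact_mod_cast hup
      rw [hMD] at this; push_cast at this; linarith
  by_cases hfar : 4 * d + 2 ≤ D
  · -- FAR REGIME: every term ≤ (4/M)^p · prof p c' z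
    have hDr : (4 : ℝ) * d + 2 ≤ D := by exact_mod_cast hfar
    have hterm : ∀ v ∈ periodBox (d := d) M, ∀ t ∈ range M,
        profW p c (((M : ℕ) : ℤ) • z + v + (t : ℤ) • e κ) κ ≤ (4 / (M : ℝ)) ^ p * ((1 + (D : ℝ) / 2) ^ p)⁻¹ := by
      intro v hv t ht
      have hlow := (hdist v hv t ht).1
      apply prof_le_of_le (by positivity)
      have hl1 : (M : ℝ) * D / 2 ≤ (l1 (((M : ℕ) : ℤ) • z + v + (t : ℤ) • e κ - c) : ℝ) := by nlinarith
      rw [div_mul_eq_mul_div, le_div_iff₀ hM0]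
      nlinarith
    calc segStepM M (profW p c) z κ
        ≤ ((M : ℝ) ^ d)⁻¹ * ∑ _v ∈ periodBox (d := d) M, ∑ _t ∈ range M, (4 / (M : ℝ)) ^ p * ((1 + (D : ℝ) / 2) ^ p)⁻¹ := by
          unfold segStepM
          exact mul_le_mul_of_nonneg_left (Finset.sum_le_sum fun v hv => Finset.sum_le_sum fun t ht => hterm v hv t ht) (by positivity)
      _ = (4 : ℝ) ^ p * ((M : ℝ) / (M : ℝ) ^ p) * prof p c' z := by
          rw [Finset.sum_const, Finset.sum_const, card_periodBox, Finset.card_range, hprofz, nsmul_eq_mul, nsmul_eq_mul, div_pow]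
          push_cast
          field_simp
      _ ≤ _ := by
          refine mul_le_mul_of_nonneg_right (mul_le_mul_of_nonneg_right (four_pow_le_cP d p) (by positivity)) (prof_nonneg _ _ _)
  · -- NEAR REGIME: `D ≤ 4d+1`; shell counting, multiplicity `M`
    rw [not_le] at hfar
    have hDle : (D : ℝ) ≤ 4 * d + 1 := by exact_mod_cast (by omega : D ≤ 4 * d + 1)
    set S : ℕ := (6 * d + 2) * M with hSdef
    have hlinf : ∀ v ∈ periodBox (d := d) M, ∀ t ∈ range M, linf (((M : ℕ) : ℤ) • z + v + (t : ℤ) • e κ - c) ≤ S := by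
      intro v hv t ht
      have h := (hdist v hv t ht).2
      have hl := linf_le_l1 (((M : ℕ) : ℤ) • z + v + (t : ℤ) • e κ - c)
      have : (linf (((M : ℕ) : ℤ) • z + v + (t : ℤ) • e κ - c) : ℝ) ≤ (6 * d + 2) * M := by
        have hl' : (linf (((M : ℕ) : ℤ) • z + v + (t : ℤ) • e κ - c) : ℝ) ≤ (l1 (((M : ℕ) : ℤ) • z + v + (t : ℤ) • e κ - c) : ℝ) := by
          exact_mod_cast hl
        nlinarith
      exact_mod_cast this
    have hinner : ∀ t ∈ range M, ∑ v ∈ periodBox (d := d) M, profW p c (((M : ℕ) : ℤ) • z + v + (t : ℤ) • e κ) κ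
        ≤ 2 * d * 4 ^ (d - 1) * ((S : ℝ) + 1) * (1 + (S : ℝ) / 2) ^ (d - 1 - p) := by
      intro t ht
      have h1 : ∀ v ∈ periodBox (d := d) M, profW p c (((M : ℕ) : ℤ) • z + v + (t : ℤ) • e κ) κ
          ≤ ((1 + (linf (((M : ℕ) : ℤ) • z + v + (t : ℤ) • e κ - c) : ℝ) / 2) ^ p)⁻¹ := by
        intro v _
        unfold profW prof
        apply inv_anti₀ (by positivity)
        apply pow_le_pow_left₀ (by positivity)
        have := linf_le_l1 (((M : ℕ) : ℤ) • z + v + (t : ℤ) • e κ - c)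
        have : (linf (((M : ℕ) : ℤ) • z + v + (t : ℤ) • e κ - c) : ℝ) ≤ l1 (((M : ℕ) : ℤ) • z + v + (t : ℤ) • e κ - c) := by
          exact_mod_cast this
        linarith
      refine (Finset.sum_le_sum h1).trans ?_
      have hinj : Set.InjOn (fun v : Site d => ((M : ℕ) : ℤ) • z + v + (t : ℤ) • e κ) (periodBox (d := d) M) := by
        intro v _ v' _ h; simpa using h
      rw [← Finset.sum_image (f := fun u => ((1 + (linf (u - c) : ℝ) / 2) ^ p)⁻¹) hinj]
      refine sum_linfProf_le hd hp _ _ S fun u hu => ?_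
      rw [Finset.mem_image] at hu
      obtain ⟨v, hv, rfl⟩ := hu
      exact hlinf v hv t ht
    have hsum : ∑ v ∈ periodBox (d := d) M, ∑ t ∈ range M, profW p c (((M : ℕ) : ℤ) • z + v + (t : ℤ) • e κ) κ
        ≤ (M : ℝ) * (2 * d * 4 ^ (d - 1) * ((S : ℝ) + 1) * (1 + (S : ℝ) / 2) ^ (d - 1 - p)) := by
      rw [Finset.sum_comm]
      calc _ ≤ ∑ _t ∈ range M, 2 * (d : ℝ) * 4 ^ (d - 1) * ((S : ℝ) + 1) * (1 + (S : ℝ) / 2) ^ (d - 1 - p) := Finset.sum_le_sum hinner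
        _ = _ := by rw [Finset.sum_const, Finset.card_range, nsmul_eq_mul]
    have hM1 : (1 : ℝ) ≤ M := by exact_mod_cast hM
    have hS1 : (S : ℝ) + 1 ≤ (6 * d + 3) * M := by
      rw [hSdef]; push_cast; nlinarith
    have hS2 : 1 + (S : ℝ) / 2 ≤ (6 * (d : ℝ) + 2) * M := by
      rw [hSdef]; push_cast; nlinarith
    have hDp : ((1 + (D : ℝ) / 2) ^ p)⁻¹ ≥ ((2 * (d : ℝ) + 2) ^ p)⁻¹ := by
      apply inv_anti₀ (by positivity)
      exact pow_le_pow_left₀ (by positivity) (by linarith) _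
    have hpd : d - 1 - p + p = d - 1 := by omega
    have hMpow : (M : ℝ) ^ (d - 1 - p) * (M : ℝ) ^ p = (M : ℝ) ^ (d - 1) := by rw [← pow_add, hpd]
    have hMd1 : (M : ℝ) ^ (d - 1) * M = (M : ℝ) ^ d := by
      rw [← pow_succ]; congr 1; omega
    calc segStepM M (profW p c) z κ
        ≤ ((M : ℝ) ^ d)⁻¹ * ((M : ℝ) * (2 * d * 4 ^ (d - 1) * ((S : ℝ) + 1) * (1 + (S : ℝ) / 2) ^ (d - 1 - p))) := by
          unfold segStepM; exact mul_le_mul_of_nonneg_left hsum (by positivity)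
      _ ≤ ((M : ℝ) ^ d)⁻¹ * ((M : ℝ) * (2 * d * 4 ^ (d - 1) * ((6 * d + 3) * M) * ((6 * (d : ℝ) + 2) * M) ^ (d - 1 - p))) := by
          gcongr
      _ = (2 * d * 4 ^ (d - 1) * (6 * d + 3) * (6 * (d : ℝ) + 2) ^ (d - 1 - p)) * ((M : ℝ) / (M : ℝ) ^ p) := by
          rw [mul_pow]
          field_simp
          rw [← hMd1, ← hMpow]
          ring
      _ = (2 * d * 4 ^ (d - 1) * (6 * d + 3) * (6 * (d : ℝ) + 2) ^ (d - 1 - p) * (2 * (d : ℝ) + 2) ^ p) * ((M : ℝ) / (M : ℝ) ^ p)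
            * ((2 * (d : ℝ) + 2) ^ p)⁻¹ := by
          field_simp
      _ ≤ (2 * d * 4 ^ (d - 1) * (6 * d + 3) * (6 * (d : ℝ) + 2) ^ (d - 1 - p) * (2 * (d : ℝ) + 2) ^ p) * ((M : ℝ) / (M : ℝ) ^ p)
            * prof p c' z := by
          rw [hprofz]; exact mul_le_mul_of_nonneg_left hDp (by positivity)
      _ ≤ cP d p * ((M : ℝ) / (M : ℝ) ^ p) * prof p c' z := by
          refine mul_le_mul_of_nonneg_right (mul_le_mul_of_nonneg_right ?_ (by positivity)) (prof_nonneg _ _ _)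
          unfold cP; have : (0 : ℝ) ≤ 4 ^ p := by positivity
          linarith

end

end Summit.QuantumFields.BalabanUV.T4Continuum.NE3MajorantProfile
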